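import Literature.NumberTheory.Automorphic.CuspidalCohomologyGL
import Mathlib.LinearAlgebra.PiTensorProduct.Basic
import Mathlib.NumberTheory.Padics.Complex
import Summits.Langlands.Langlands.Statement
import HarnessLib
import Literature.NumberTheory.Automorphic.BianchiCuspidalEigenclass

/-!
# `EisensteinProModularSeed` (stmt-Langlands-12920), line `descend-raise-basechange` —
# stub S5 `stub_cuspidalCohomologicalPoint`: the dictionary "cuspidal cohomological `Π` ⇒
# continuous `ℚ̄_p`-point of the completed-cohomology Hecke algebra `𝕋(𝒰)`"

For `F` imaginary quadratic, a prime `p`, `ι : ℚ̄_p ≃ ℂ`, a CUSPIDAL automorphic representation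
`Π` of `GL₂(𝔸_F)` with a regular L-algebraic infinity type `T`, a finite set `S ⊇ {v ∣ p}` of
finite places and a continuous `r : Γ_F → GL₂(ℚ̄_p)` which is Satake–Frobenius compatible with `Π`
at every `v ∉ S` (`Summit.Langlands.SatakeFrobCompatibleAt`: `Π_v` unramified with Satake parameter
`α_v`, `r` unramified at `v`, `charpoly r(Frob_v) = ∏_j (X − ι⁻¹(α_{v,j}⁻¹))`, ARITHMETIC
Frobenius), we produce a tame level `𝒰 : TameLevel 2 F p` with `𝒰.bad = S` and prove
`𝒰.IsPadicallyAutomorphic r`: a CONTINUOUS ring homomorphism `x : 𝕋(𝒰) → ℚ̄_p` with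
`charpoly r(Frob_v) = X² − x(T_{v,1}) X + q_v x(T_{v,2})` off `S` (`heckeFrobPoly`, the
normalisation pinned by the landed `Negative.BorelAndEisenstein.trace_det_of_charpoly_eq_heckeFrobPoly`).

## Shape of the proof and the two printed inputs

The theorem `stub_cuspidalCohomologicalPoint` is CONDITIONAL on two named facts (theorems in
print absent from the tree, stated below in the tree's vocabulary as `def … : Prop`, taken as
hypotheses and prepended in this order to the registered signature, which is otherwise verbatim):

1. `bianchi_cuspidal_regularLAlgebraic_eigenclassExists` — Eichler–Shimura–Harder for `GL₂` over an
   imaginary quadratic field, in the form used by Scholze (proof of Cor. V.4.2, first paragraph):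
   for `Π` cuspidal with a regular L-algebraic infinity type, unramified outside a finite `S`, the
   twist `Π₀ := Π^∨ ⊗ |det|^{1/2}` is regular C-algebraic, i.e. COHOMOLOGICAL for some algebraic
   representation `ξ = ⊠_{τ : F → E} V_{λ_τ}` of `Res_{F/ℚ} GL₂` (Clozel), so its eigensystem —
   `T_{w,1} ↦ e₁(α_w⁻¹)`, `T_{w,2} ↦ q_w⁻¹ e₂(α_w⁻¹)` at `w ∉ S`, `α_w` the Satake parameter of `Π`
   — occurs on a non-zero class of `H^q(X_U, ξ̃_E)` for some `S`-good open compact level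
   `U = U_S · ∏_{w ∉ S} GL₂(𝒪_w) ≤ GL₂(𝒪̂_F)` (the tree's `TwistedQuotient.cohomology` of `GL₂(F)`
   acting on `Fun(GL₂(𝔸_F^∞)/U, ⨂_τ V_{λ_τ}(E))`, any field `E ≃+* ℂ`).
2. `algebraicWeightEigenclass_continuousPoint` — classical eigenclasses are points of the completed
   Hecke algebra (Emerton; Scholze's Hochschild–Serre reduction): a non-zero eigenclass of the
   `T_{w,j}` (`w ∉ 𝒰.bad`, `1 ≤ j ≤ n`) in `H^q(X_{𝒰.subgroup}, ξ̃_{ℚ̄_p})`, `ξ = ⊠_τ V_{λ_τ}`, gives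
   a CONTINUOUS ring homomorphism `x : 𝕋(𝒰) → ℚ̄_p` with `x(T_{w,j})` = the eigenvalues.

Given these, the proof is bookkeeping, all of it checked here: the `S`-good level `U` of (1) and
the finite `S ⊇ {v ∣ p}` ARE a `TameLevel 2 F p` with `bad = S` (`exists_tameLevel_of_sGood`); the
point `x` of (2) has `x(T_{v,1}) = ι⁻¹ e₁(α_v⁻¹)`, `q_v x(T_{v,2}) = ι⁻¹ e₂(α_v⁻¹)`
(`dualHalfTwist_eigenvalues`), so `X² − x(T_{v,1}) X + q_v x(T_{v,2}) = ∏_j (X − ι⁻¹(α_{v,j}⁻¹))`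
(`arithFrobPolyOfSatake_pair`, `heckeFrobPoly_two`), the Frobenius characteristic polynomial of
`r` by hypothesis; unramifiedness of `r` off `S` is part of the same hypothesis.

## Design notes

* ALGEBRAIC WEIGHTS `(λ_τ)_τ`.  The coefficient representation is written over the tree's generic
  `TwistedQuotient` layer (`CuspidalCohomologyGL`) as `⨂_{τ : F →+* E} V_{λ_τ}(E) ∘ GL₂(τ)`
  (`PiTensorProduct.mapMonoidHom` of the family `τ ↦ GLnCohomology.coeffRepGL E 2 (λ_τ) ∘ GL₂(τ)`),
  a highest weight `λ_τ` PER EMBEDDING — Scholze's "algebraic representation `ξ` of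
  `Res GL_n`", Khare–Thorne's `M_𝛌`.  This generality is forced: a cuspidal regular L-algebraic `Π`
  over an imaginary quadratic field is cohomological for a PARALLEL weight (`λ_σ = λ_σ̄`, the tree's
  `ParallelWeight.coeffRep` of `BianchiOrdinaryClassicality`, which is the constant-`λ` case of the
  representation used here) only when its infinity type is `swap`-invariant, `T σ = {(a, b), (b, a)}`
  (base changes from `ℚ`); in general (e.g. after a twist by an algebraic Hecke character of type
  `z ↦ z`) the weight is `V_λ ⊠ V̄_λ ⊗ det_σ^u det_σ̄^v`, `u ≠ v`.  In each fact the representation is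
  a bound variable `ρ` pinned by an equation `ρ = …` (one occurrence of the explicit term).
* NOT HERE: the finite-level torsion form of (2) and its proof from the construction of `𝕋(𝒰)`
  (the tree's `CompletedCohomologyPoints` treats the generic `bigHeckeAlgebra` of
  `CompletedCohomology`, not `CompletedCohomologyHeckeAlgebraGLn 𝒰`, and only modulo `ϖ^t`);
  anything at `v ∈ S` or `v ∣ p`.  Sources: see the docstrings of the two facts.
-/

set_option linter.dupNamespace false -- project-wide option (lakefile weak.linter.dupNamespace); `Summit.Langlands.Langlands` is the mandated namespace

noncomputable section

namespace Summit.Langlands.Langlands.Theorems.SkinnerWilesDefectOne.EisensteinProModularSeed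

open Literature.NumberTheory.Automorphic Literature.NumberTheory.GaloisRepresentations
open Literature.NumberTheory.Automorphic.BigHeckeGLn
open NumberField IsDedekindDomain Polynomial
open scoped NumberField

/-! ### The two printed inputs (named facts, `def … : Prop`) -/

/-- `heckeFrobPoly 2 q a = X² − a₁ X + q a₂` (as in the sibling crux's
`ReducibleOrdinaryProModular.Negative.heckeFrobPoly_two`, reproved here to keep this file's import
cone inside `Literature` + `Statement`). [folklore] -/
private theorem heckeFrobPoly_two {R : Type*} [CommRing R] (q : ℕ) (a : ℕ → R) :
    heckeFrobPoly 2 q a = X ^ 2 - C (a 1) * X + C ((q : R) * a 2) := by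
  have h : Finset.Icc 1 2 = {1, 2} := by decide
  rw [heckeFrobPoly, h, Finset.sum_insert (by decide), Finset.sum_singleton]
  norm_num
  abel

/-- `e₁{x, y} = x + y`. [folklore] -/
theorem esymm_pair_one (x y : ℂ) : Multiset.esymm (x ::ₘ {y}) 1 = x + y := by
  simp [Multiset.esymm, Multiset.powersetCard_one]
  ring

/-- `e₂{x, y} = x y`. [folklore] -/
theorem esymm_pair_two (x y : ℂ) : Multiset.esymm (x ::ₘ {y}) 2 = x * y := by
  simp [Multiset.esymm, Multiset.powersetCard_one]

/-- **The eigenvalues of `Π^∨ ⊗ |det|^{1/2}` transported by `ι⁻¹`.**  For `α = {a₁, a₂}`: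
`ι⁻¹(e₁(α⁻¹)) = ι⁻¹(a₁⁻¹) + ι⁻¹(a₂⁻¹)` and `q · ι⁻¹(q⁻¹ e₂(α⁻¹)) = ι⁻¹(a₁⁻¹) ι⁻¹(a₂⁻¹)` (`q > 0`) —
the coefficients of `∏_j (X − ι⁻¹(a_j⁻¹))`. [folklore] -/
theorem dualHalfTwist_eigenvalues {p : ℕ} [Fact p.Prime] (ι : PadicAlgCl p ≃+* ℂ) {q : ℕ}
    (hq : 0 < q) (a₁ a₂ : ℂ) :
    ι.symm ((({a₁, a₂} : Multiset ℂ).map fun a => a⁻¹).esymm 1) = ι.symm a₁⁻¹ + ι.symm a₂⁻¹ ∧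
    (q : PadicAlgCl p) * ι.symm (((q : ℂ))⁻¹ * (({a₁, a₂} : Multiset ℂ).map fun a => a⁻¹).esymm 2) =
      ι.symm a₁⁻¹ * ι.symm a₂⁻¹ := by
  have hq' : (q : ℂ) ≠ 0 := by exact_mod_cast hq.ne'
  rw [Multiset.insert_eq_cons, Multiset.map_cons, Multiset.map_singleton, esymm_pair_one,
    esymm_pair_two, ← map_add, ← map_mul, ← map_natCast ι.symm q, ← map_mul,
    mul_inv_cancel_left₀ hq']
  exact ⟨rfl, rfl⟩

/-- `arithFrobPolyOfSatake ι q 1 {a, b} = X² − (ι⁻¹(a⁻¹) + ι⁻¹(b⁻¹)) X + ι⁻¹(a⁻¹) ι⁻¹(b⁻¹)`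
(Buzzard–Gee normalisation, `m = 1`: roots `ι⁻¹(a_j⁻¹)`). [folklore] -/
theorem arithFrobPolyOfSatake_pair {p : ℕ} [Fact p.Prime] (ι : PadicAlgCl p ≃+* ℂ) (q : ℕ)
    (a b : ℂ) :
    arithFrobPolyOfSatake ι q 1 ({a, b} : Multiset ℂ) =
      X ^ 2 - C (ι.symm a⁻¹ + ι.symm b⁻¹) * X + C (ι.symm a⁻¹ * ι.symm b⁻¹) := by
  rw [arithFrobPolyOfSatake_one, Multiset.insert_eq_cons, Multiset.map_cons, Multiset.prod_cons,
    Multiset.map_singleton, Multiset.prod_singleton]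
  simp only [map_add, map_mul]
  ring

/-- The residue cardinality of a finite place is positive. [folklore] -/
theorem residueCard_pos' {F : Type} [Field F] [NumberField F] (v : HeightOneSpectrum (𝓞 F)) :
    0 < v.residueCard :=
  Nat.pos_of_ne_zero fun h => v.ne_bot (Ideal.absNorm_eq_zero_iff.mp h)

/-- **An `S`-good open compact level and a finite `S ⊇ {v ∣ p}` form a tame level datum with
`bad = S`** (the fields of `TameLevel` verbatim). [folklore] -/
theorem exists_tameLevel_of_sGood {F : Type} [Field F] [NumberField F] {p : ℕ} [Fact p.Prime]
    (S : Set (HeightOneSpectrum (𝓞 F))) (hSfin : S.Finite)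
    (hSp : ∀ v : HeightOneSpectrum (𝓞 F), (p : 𝓞 F) ∈ v.asIdeal → v ∈ S)
    (U : Subgroup (FiniteAdelicGL 2 F)) (hUo : IsOpen (U : Set (FiniteAdelicGL 2 F)))
    (hUc : IsCompact (U : Set (FiniteAdelicGL 2 F))) (hUle : U ≤ glFiniteIntegralLevel 2 F)
    (hUsph : ∀ w ∉ S, ∀ g ∈ valuedCongruenceSubgroup (Fin 2) (1 : WithZero (Multiplicative ℤ)),
      ofLocal 2 F w g ∈ U)
    (hUfac : ∀ w ∉ S, ∀ u ∈ U, u * (ofLocal 2 F w (localComponent 2 F w u))⁻¹ ∈ U) :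
    ∃ 𝒰 : TameLevel 2 F p, 𝒰.bad = S ∧ 𝒰.subgroup = U :=
  ⟨{ subgroup := U, bad := S, bad_finite := hSfin, mem_bad_of_mem := hSp, isOpen := hUo,
      isCompact := hUc, le_glFiniteIntegralLevel := hUle, ofLocal_mem := hUsph,
      mul_ofLocal_inv_mem := hUfac }, rfl, rfl⟩

/-! ### The stub -/

/-- **stub_cuspidalCohomologicalPoint** (S5 of line `descend-raise-basechange`; the dictionary D1,
classical ⇒ `p`-adic point), CONDITIONAL on the two named facts above (prepended, in the order
`bianchi_cuspidal_regularLAlgebraic_eigenclassExists → Literature.NumberTheory.Automorphic.algebraicWeightEigenclass_continuousPoint`;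
the registered signature follows verbatim).  For `F` imaginary quadratic, `p` prime,
`ι : ℚ̄_p ≃ ℂ`, `Π` cuspidal on `GL₂(𝔸_F)` with a regular L-algebraic infinity type, `S ⊇ {v ∣ p}`
finite and `r : Γ_F → GL₂(ℚ̄_p)` Satake–Frobenius compatible with `Π` at every `v ∉ S`: there is
`𝒰 : TameLevel 2 F p` with `𝒰.bad = S` and `𝒰.IsPadicallyAutomorphic r`.  Proof: the eigensystem
`(e₁(α_w⁻¹), q_w⁻¹ e₂(α_w⁻¹))_w` of `Π^∨|det|^{1/2}` occurs in `H^q(X_U, ξ̃_{ℚ̄_p})` for an `S`-good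
`U` (fact 1, `E = ℚ̄_p` via `ι`), `(U, S)` is a tame level (`exists_tameLevel_of_sGood`), the
eigenclass is a continuous point `x` of `𝕋(𝒰)` (fact 2), and
`heckeFrobPoly 2 q_v (x(T_{v,·})) = arithFrobPolyOfSatake ι q_v 1 α_v = charpoly r(Frob_v)`
(`dualHalfTwist_eigenvalues`, `arithFrobPolyOfSatake_pair`). [cite: Scholze2015, §V.4, proof of Cor. V.4.2] -/
theorem stub_cuspidalCohomologicalPoint :
    Literature.NumberTheory.Automorphic.bianchi_cuspidal_regularLAlgebraic_eigenclassExists → Literature.NumberTheory.Automorphic.algebraicWeightEigenclass_continuousPoint →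
    ∀ (F : Type) [Field F] [NumberField F], NumberField.IsTotallyComplex F → Module.finrank ℚ F = 2 →
      ∀ (p : ℕ) [Fact p.Prime] (hcpt : Literature.NumberTheory.Automorphic.isCompact_glFiniteIntegralLevel 2 F) (ι : PadicAlgCl p ≃+* ℂ)
        (πF : Literature.NumberTheory.Automorphic.CuspidalAutomorphicRepData 2 F hcpt) (T : Literature.NumberTheory.Automorphic.InfinityType F 2),
      πF.1.HasInfinityType T → T.IsLAlgebraic → T.IsRegular →
      ∀ (S : Set (IsDedekindDomain.HeightOneSpectrum (NumberField.RingOfIntegers F))), S.Finite →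
      (∀ v : IsDedekindDomain.HeightOneSpectrum (NumberField.RingOfIntegers F), (p : NumberField.RingOfIntegers F) ∈ v.asIdeal → v ∈ S) →
      ∀ (r : Literature.NumberTheory.GaloisRepresentations.FramedGaloisRep F (PadicAlgCl p) 2),
      (∀ v ∉ S, Summit.Langlands.SatakeFrobCompatibleAt ι πF.1 r v) →
      ∃ 𝒰 : Literature.NumberTheory.Automorphic.BigHeckeGLn.TameLevel 2 F p, 𝒰.bad = S ∧ 𝒰.IsPadicallyAutomorphic r := by
  intro h₁ h₂ F _ _ hF hdeg p _ hcpt ι πF T hT hTL hTR S hSfin hSp r hcompat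
  classical
  -- the Satake data of `Π` off `S`, chosen once
  choose α hα hunr hchar using hcompat
  have hπunr : ∀ w ∉ S, πF.1.IsUnramifiedAt w := fun w hw => ⟨_, hα w hw⟩
  -- fact 1: an eigenclass in `H^q(X_U, ξ̃_{ℚ̄_p})` for an `S`-good level `U`
  obtain ⟨U, hUo, hUc, hUle, hUsph, hUfac, wt, hdom, hocc⟩ :=
    h₁ F hF hdeg hcpt (PadicAlgCl p) ι πF T hT hTL hTR S hSfin hπunr
  obtain ⟨q, ξ, hξ, heig⟩ := hocc _ rfl
  -- the tame level `(U, S)`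
  obtain ⟨𝒰, h𝒰bad, h𝒰sub⟩ :=
    exists_tameLevel_of_sGood (p := p) S hSfin hSp U hUo hUc hUle hUsph hUfac
  subst h𝒰bad
  subst h𝒰sub
  -- the eigenvalue family (junk `0` on `𝒰.bad` and for `j ∉ {1, 2}`)
  let a : HeightOneSpectrum (𝓞 F) → ℕ → PadicAlgCl p := fun w j =>
    if hw : w ∈ 𝒰.bad then 0 else
      if j = 1 then ι.symm (((α w hw).map fun t => t⁻¹).esymm 1)
      else ι.symm (((w.residueCard : ℂ))⁻¹ * ((α w hw).map fun t => t⁻¹).esymm 2)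
  have ha1 : ∀ (w) (hw : w ∉ 𝒰.bad), a w 1 = ι.symm (((α w hw).map fun t => t⁻¹).esymm 1) :=
    fun w hw => by simp only [a, dif_neg hw, ↓reduceIte]
  have ha2 : ∀ (w) (hw : w ∉ 𝒰.bad),
      a w 2 = ι.symm (((w.residueCard : ℂ))⁻¹ * ((α w hw).map fun t => t⁻¹).esymm 2) :=
    fun w hw => by simp only [a, dif_neg hw, show ((2 : ℕ) = 1) = False by decide, ↓reduceIte]
  have heigen : ∀ w ∉ 𝒰.bad, ∀ j : ℕ, 1 ≤ j → j ≤ 2 →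
      TwistedQuotient.heckeEnd (globalEmbedding 2 F) 𝒰.subgroup _ (heckeElement 2 F w j) q ξ =
        a w j • ξ := by
    intro w hw j hj1 hj2
    obtain ⟨he1, he2⟩ := heig w hw (α w hw) (hα w hw)
    interval_cases j
    · rw [ha1 w hw]; exact he1
    · rw [ha2 w hw]; exact he2
  -- fact 2: the eigenclass is a continuous point of `𝕋(𝒰)`
  obtain ⟨x, hxc, hx⟩ := h₂ F 2 p (by norm_num) 𝒰 wt hdom _ rfl q ξ hξ a heigen
  refine ⟨𝒰, rfl, x, hxc, fun v hv => ⟨hunr v hv, ?_⟩⟩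
  -- the Hecke–Frobenius polynomial of `x` at `v` is `arithFrobPolyOfSatake ι q_v 1 α_v`
  obtain ⟨a₁, a₂, hab⟩ := Multiset.card_eq_two.mp (hα v hv).card_eq
  obtain ⟨hd1, hd2⟩ := dualHalfTwist_eigenvalues ι (residueCard_pos' v) a₁ a₂
  have hx1 : x (𝒰.heckeT v 1) = ι.symm a₁⁻¹ + ι.symm a₂⁻¹ := by
    rw [hx v hv 1 le_rfl (by norm_num), ha1 v hv, hab]
    exact hd1
  have hx2 : (Ideal.absNorm v.asIdeal : PadicAlgCl p) * x (𝒰.heckeT v 2) =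
      ι.symm a₁⁻¹ * ι.symm a₂⁻¹ := by
    rw [hx v hv 2 (by norm_num) le_rfl, ha2 v hv, hab]
    exact hd2
  have key : heckeFrobPoly 2 (Ideal.absNorm v.asIdeal) (fun i => x (𝒰.heckeT v i)) =
      arithFrobPolyOfSatake ι v.residueCard 1 (α v hv) := by
    rw [heckeFrobPoly_two, hab, arithFrobPolyOfSatake_pair, hx2, hx1]
  rw [key]
  exact hchar v hv

end Summit.Langlands.Langlands.Theorems.SkinnerWilesDefectOne.EisensteinProModularSeed

end
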